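import Summits.ResolutionOfSingularities.ResolutionOfSingularities.Theses.PAlteration
import Literature.Barriers.ResolutionOfSingularities.InseparableBaseChangeResolution

/-!
# Negative lemmas for crux `PicoverLocalModel` (stmt-ResolutionOfSingularities-0557): which
# hypotheses are load-bearing, and what the crux is worth

The crux (route `pAlteration`, rank 5) reads: for every prime `p`, every field `k` of
characteristic `p`, every regular finitely generated `k`-domain `R` and every `a ∈ R`, the affine
scheme `Spec (R[T]/(T^p - a))_red` — Lean: `Spec (AdjoinRoot (X ^ p - C a) ⧸ nilradical _)` — has a
resolution of singularities (`Scheme.HasResolution`, the weak form: a proper morphism from a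
regular scheme which is an isomorphism over a dense open with dense preimage).

Findings of the standing disprover (cdisprove, cycle 1), all PROVED here:

* §1 WEB. The summit implies the crux (`localModel_of_resolutionInChar`: the model is a reduced
  affine scheme of finite type over `k`). Hence a kill of this crux is a counterexample to
  resolution of singularities in characteristic `p` (`not_summit_of_not_picoverLocalModel`); none
  is known or conjectured, and in dimension `dim R ≤ 3` the crux HOLDS modulo the named fact
  `CossartPiltant2019` (`localModel_of_dim_le_three`; the model has the dimension of `R`,
  `ringKrullDim_localModelRing`). The open case is exactly `dim R ≥ 4`
  (`Literature.Barriers.ResolutionOfSingularities.DimensionFourFrontier`).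
* §2 REDUCEDNESS (`⧸ nilradical`) IS LOAD-BEARING: with it dropped the statement is false at every
  prime — `k = R = 𝔽_p`, `a = 0`: `Spec 𝔽_p[T]/(T^p)` is one non-reduced point
  (`picoverLocalModel_false_without_red_at`, `picoverLocalModel_false_without_red`). The cases
  `a = 0` and `a = b^p` are where the raw ring `R[T]/(T^p - a)` is not reduced.
* §3 REGULARITY OF `R` IS LOAD-BEARING IN THE STRONG SENSE: at `a = 0` the model collapses to
  `Spec R` (`hasResolution_localModel_zero_iff`), so the crux with `IsRegularRing R` dropped
  contains resolution of EVERY integral affine scheme of finite type over every field of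
  characteristic `p` (`affineRes_of_picoverLocalModel_without_regular`) — the affine heart of
  the summit, open from dimension `4`; conversely the summit gives it
  (`picoverLocalModel_without_regular_of_summit`).
* §4 FINITE TYPE OVER A FIELD (EXCELLENCE) IS LOAD-BEARING modulo one folklore link: see the
  companion file `FiniteTypeLoadBearing.lean` in this directory (F. K. Schmidt's discrete
  valuation ring, Kollár 2007 Claim 1.104).
* §5 DEGENERATE INSTANCES DO NOT BITE: `a = 0` (`localModel_zero`), fields, and the hypotheses
  are jointly satisfiable with true conclusion (`picoverLocalModel_hypotheses_satisfiable`).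

Informal notes (not formalised): `IsDomain R` is not load-bearing (a regular Noetherian ring is a
finite product of regular domains and the model of a product is the disjoint union);
`CharP k p` / `p.Prime` only tie `p` to `k` (for `p = 0`, i.e. characteristic zero, the statement
is Hironaka's theorem; no field has composite characteristic); the natural strengthening "the
model is itself regular" is false already over a curve (`t² = x³` over `𝔽₂[x]`, the cusp), and
"the normalization of the model is regular" is false from `dim R = 2` (`t² = xy`).
-/

noncomputable section

open CategoryTheory AlgebraicGeometry TopologicalSpace Polynomial
open Literature.AlgebraicGeometry.Resolution
open Summit.ResolutionOfSingularities.ResolutionOfSingularities.Theses.PAlteration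

set_option linter.dupNamespace false

namespace Summit.ResolutionOfSingularities.ResolutionOfSingularities.Theorems.PicoverLocalModel.Negative

/-! ## §0 The coordinate ring `(R[T]/(T^p - a))_red` of the local model -/

section Ring

variable (p : ℕ) {R : Type} [CommRing R] (a : R)

/-- The model ring is reduced. [folklore] -/
theorem isReduced_localModelRing :
    _root_.IsReduced (AdjoinRoot (X ^ p - C a) ⧸ nilradical (AdjoinRoot (X ^ p - C a))) :=
  (Ideal.isRadical_iff_quotient_reduced _).mp (Ideal.radical_isRadical ⊥)

/-- The model ring is of finite type over `R`. [folklore] -/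
theorem finiteType_localModelRing :
    Algebra.FiniteType R (AdjoinRoot (X ^ p - C a) ⧸ nilradical (AdjoinRoot (X ^ p - C a))) := by
  infer_instance

/-- … hence of finite type over `k` when `R` is. [folklore] -/
theorem finiteType_localModelRing_of (k : Type) [Field k] [Algebra k R]
    (hR : Algebra.FiniteType k R) :
    Algebra.FiniteType k (AdjoinRoot (X ^ p - C a) ⧸ nilradical (AdjoinRoot (X ^ p - C a))) :=
  Algebra.FiniteType.trans hR (finiteType_localModelRing p a)

/-- `R → (R[T]/(T^p - a))_red` is injective for a domain `R` and `p ≠ 0`. [folklore] -/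
theorem algebraMap_localModelRing_injective [IsDomain R] (hp : 0 < p) :
    Function.Injective
      (algebraMap R (AdjoinRoot (X ^ p - C a) ⧸ nilradical (AdjoinRoot (X ^ p - C a)))) := by
  intro r s hrs
  rw [← sub_eq_zero] at hrs ⊢
  rw [← map_sub] at hrs
  set d := r - s
  have h1 : algebraMap R (AdjoinRoot (X ^ p - C a) ⧸ nilradical (AdjoinRoot (X ^ p - C a))) d =
      Ideal.Quotient.mk _ (AdjoinRoot.of ((X : R[X]) ^ p - C a) d) := rfl
  rw [h1, Ideal.Quotient.eq_zero_iff_mem, mem_nilradical] at hrs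
  obtain ⟨n, hn⟩ := hrs
  rw [← map_pow, ← map_zero (AdjoinRoot.of ((X : R[X]) ^ p - C a))] at hn
  have hinj : Function.Injective (AdjoinRoot.of ((X : R[X]) ^ p - C a)) :=
    AdjoinRoot.of.injective_of_degree_ne_zero (by
      rw [degree_X_pow_sub_C hp]; exact_mod_cast hp.ne')
  exact IsReduced.eq_zero d ⟨n, hinj hn⟩

/-- `R[T]/(T^p - a)` is a finite `R`-module (`p ≠ 0`). [folklore] -/
theorem finite_adjoinRoot (hp : p ≠ 0) : Module.Finite R (AdjoinRoot ((X : R[X]) ^ p - C a)) :=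
  (AdjoinRoot.powerBasis' (monic_X_pow_sub_C a hp)).finite

/-- The model ring is a finite `R`-module (`p ≠ 0`). [folklore] -/
theorem finite_localModelRing (hp : p ≠ 0) :
    Module.Finite R (AdjoinRoot (X ^ p - C a) ⧸ nilradical (AdjoinRoot (X ^ p - C a))) :=
  haveI := finite_adjoinRoot p a hp
  Module.Finite.trans (AdjoinRoot ((X : R[X]) ^ p - C a)) _

/-- The model ring is integral over `R` (`p ≠ 0`). [folklore] -/
theorem isIntegral_localModelRing (hp : p ≠ 0) :
    Algebra.IsIntegral R (AdjoinRoot (X ^ p - C a) ⧸ nilradical (AdjoinRoot (X ^ p - C a))) :=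
  haveI := finite_localModelRing p a hp
  Algebra.IsIntegral.of_finite R _

/-- **The model has the dimension of `R`** (`R` a domain, `p ≠ 0`). [folklore] -/
theorem ringKrullDim_localModelRing [IsDomain R] (hp : 0 < p) :
    ringKrullDim (AdjoinRoot (X ^ p - C a) ⧸ nilradical (AdjoinRoot (X ^ p - C a))) =
      ringKrullDim R :=
  haveI := isIntegral_localModelRing p a hp.ne'
  ringKrullDim_eq_of_isIntegral (algebraMap_localModelRing_injective p a hp)

end Ring

/-- The underlying space of `Spec B` has Krull dimension `dim B`. [folklore] -/
theorem topologicalKrullDim_Spec (B : Type) [CommRing B] :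
    topologicalKrullDim (Spec (.of B)) = ringKrullDim B :=
  PrimeSpectrum.topologicalKrullDim_eq_ringKrullDim B

/-- `Spec A → Spec k` is locally of finite type when `A` is a `k`-algebra of finite type.
[folklore] -/
theorem locallyOfFiniteType_Spec_of_finiteType (k A : Type) [CommRing k] [CommRing A]
    [Algebra k A] [h : Algebra.FiniteType k A] :
    LocallyOfFiniteType (Spec.map (CommRingCat.ofHom (algebraMap k A))) := by
  rw [HasRingHomProperty.Spec_iff (P := @LocallyOfFiniteType), CommRingCat.hom_ofHom]
  exact RingHom.finiteType_algebraMap.mpr h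

/-! ## §1 Web: the summit implies the crux; dimension `≤ 3` is settled by Cossart–Piltant -/

/-- **The crux at exponent `p` follows from resolution in characteristic `p`**: the model is a
reduced affine scheme of finite type over `k`. [folklore] -/
theorem localModel_of_resolutionInChar (p : ℕ) (h : ResolutionInChar.{0} p) (k : Type) [Field k]
    [CharP k p] (R : Type) [CommRing R] [Algebra k R] (hft : Algebra.FiniteType k R) (a : R) :
    Scheme.HasResolution
      (Spec (.of (AdjoinRoot (X ^ p - C a) ⧸ nilradical (AdjoinRoot (X ^ p - C a))))) := by
  haveI := finiteType_localModelRing_of p a k hft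
  haveI := isReduced_localModelRing p a
  haveI : IsReduced
      (Spec (.of (AdjoinRoot (X ^ p - C a) ⧸ nilradical (AdjoinRoot (X ^ p - C a))))) :=
    (affine_isReduced_iff (CommRingCat.of _)).mpr inferInstance
  exact h k (Spec (.of _)) (Spec.map (CommRingCat.ofHom (algebraMap k _))) inferInstance
    (locallyOfFiniteType_Spec_of_finiteType k _) inferInstance inferInstance

/-- **A kill of the crux kills the summit** (the summit implies the crux: apply
`localModel_of_resolutionInChar` at every prime). [folklore] -/
theorem not_summit_of_not_picoverLocalModel (h : ¬ PicoverLocalModel) :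
    ¬ _root_.ResolutionOfSingularities := fun hs =>
  h fun p hp k _ _ R _ _ _ hft _ a => localModel_of_resolutionInChar p (hs p hp) k R hft a

/-- **Dimension `≤ 3` is settled** modulo the named fact `CossartPiltant2019`: the model has the
dimension of `R`. The open case of the crux is exactly `dim R ≥ 4`.
[cite: CossartPiltant2019, Thm. 1.1] -/
theorem localModel_of_dim_le_three (hCP : CossartPiltant2019.{0}) (p : ℕ) (hp : p.Prime)
    (k : Type) [Field k] [CharP k p] (R : Type) [CommRing R] [IsDomain R] [Algebra k R]
    (hft : Algebra.FiniteType k R) (hdim : ringKrullDim R ≤ 3) (a : R) :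
    Scheme.HasResolution
      (Spec (.of (AdjoinRoot (X ^ p - C a) ⧸ nilradical (AdjoinRoot (X ^ p - C a))))) := by
  haveI := finiteType_localModelRing_of p a k hft
  haveI := isReduced_localModelRing p a
  haveI : IsReduced
      (Spec (.of (AdjoinRoot (X ^ p - C a) ⧸ nilradical (AdjoinRoot (X ^ p - C a))))) :=
    (affine_isReduced_iff (CommRingCat.of _)).mpr inferInstance
  haveI := locallyOfFiniteType_Spec_of_finiteType k
    (AdjoinRoot (X ^ p - C a) ⧸ nilradical (AdjoinRoot (X ^ p - C a)))
  refine hasResolution_of_dim_le_three hCP k (Spec (.of _))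
    (Spec.map (CommRingCat.ofHom (algebraMap k _))) ?_
  rw [topologicalKrullDim_Spec, ringKrullDim_localModelRing p a hp.pos]
  exact hdim

/-! ## §2 Reducedness is load-bearing: `R[T]/(T^p - a)` itself need not have a resolution -/

/-- `T` is nilpotent in `R[T]/(T^n)`. [folklore] -/
theorem isNilpotent_root_X_pow_sub_C_zero (R : Type*) [CommRing R] (n : ℕ) :
    IsNilpotent (AdjoinRoot.root ((X : R[X]) ^ n - C 0)) :=
  ⟨n, by rw [← AdjoinRoot.mk_X, ← map_pow, AdjoinRoot.mk_eq_zero, map_zero, sub_zero]⟩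

/-- Every element of `k[T]/(T^n)`, `k` a field, is a unit or nilpotent. [folklore] -/
theorem isUnit_or_isNilpotent_adjoinRoot_X_pow (k : Type*) [Field k] (n : ℕ)
    (z : AdjoinRoot ((X : k[X]) ^ n - C 0)) : IsUnit z ∨ IsNilpotent z := by
  induction z using AdjoinRoot.induction_on with
  | ih q =>
    have hq : q = X * q.divX + C (q.coeff 0) := (X_mul_divX_add q).symm
    have hnil : IsNilpotent (AdjoinRoot.mk ((X : k[X]) ^ n - C 0) (X * q.divX)) := by
      rw [map_mul, AdjoinRoot.mk_X]
      exact Commute.isNilpotent_mul_right (Commute.all _ _) (isNilpotent_root_X_pow_sub_C_zero k n)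
    by_cases h0 : q.coeff 0 = 0
    · right
      have hq' : q = X * q.divX := by
        conv_lhs => rw [hq, h0, map_zero, add_zero]
      rw [hq']
      exact hnil
    · left
      rw [hq, map_add, AdjoinRoot.mk_C]
      have hu : IsUnit (AdjoinRoot.of ((X : k[X]) ^ n - C 0) (q.coeff 0)) :=
        (isUnit_iff_ne_zero.mpr h0).map _
      exact IsNilpotent.isUnit_add_right_of_commute hnil hu (Commute.all _ _)

/-- `k[T]/(T^n)` is not reduced for `n ≥ 2`. [folklore] -/
theorem not_isReduced_adjoinRoot_X_pow (k : Type*) [Field k] (n : ℕ) (hn : 2 ≤ n) :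
    ¬ _root_.IsReduced (AdjoinRoot ((X : k[X]) ^ n - C 0)) := by
  intro h
  have h0 := h.eq_zero _ (isNilpotent_root_X_pow_sub_C_zero k n)
  rw [← AdjoinRoot.mk_X] at h0
  refine AdjoinRoot.mk_ne_zero_of_degree_lt (by rw [map_zero, sub_zero]; exact monic_X_pow n)
    X_ne_zero ?_ h0
  rw [map_zero, sub_zero, degree_X, degree_X_pow]
  exact_mod_cast hn

/-- **`Spec k[T]/(T^n)`, `n ≥ 2`, has no resolution** (one non-reduced point). [folklore] -/
theorem not_hasResolution_Spec_adjoinRoot_X_pow (k : Type) [Field k] (n : ℕ) (hn : 2 ≤ n) :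
    ¬ Scheme.HasResolution (Spec (.of (AdjoinRoot ((X : k[X]) ^ n - C 0)))) :=
  Literature.Barriers.ResolutionOfSingularities.not_hasResolution_Spec_of_isUnit_or_isNilpotent
    (isUnit_or_isNilpotent_adjoinRoot_X_pow k n) (not_isReduced_adjoinRoot_X_pow k n hn)

/-- **At every prime the crux with `⧸ nilradical` dropped fails**: `k = R = 𝔽_p` (a regular
finitely generated `𝔽_p`-domain), `a = 0`. [folklore] -/
theorem picoverLocalModel_false_without_red_at (p : ℕ) [hp : Fact p.Prime] :
    ¬ ∀ (k : Type) [Field k] [CharP k p] (R : Type) [CommRing R] [IsDomain R]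
      [Algebra k R], Algebra.FiniteType k R → IsRegularRing R → ∀ a : R,
        Scheme.HasResolution (Spec (.of (AdjoinRoot ((X : R[X]) ^ p - C a)))) := fun h =>
  not_hasResolution_Spec_adjoinRoot_X_pow (ZMod p) p hp.out.two_le
    (h (ZMod p) (ZMod p) inferInstance inferInstance 0)

/-- **Any proof of the crux must use the reduction `⧸ nilradical`**: the statement for
`Spec R[T]/(T^p - a)` itself is false (already at `p = 2`). [folklore] -/
theorem picoverLocalModel_false_without_red :
    ¬ ∀ p : ℕ, p.Prime → ∀ (k : Type) [Field k] [CharP k p] (R : Type) [CommRing R] [IsDomain R]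
      [Algebra k R], Algebra.FiniteType k R → IsRegularRing R → ∀ a : R,
        Scheme.HasResolution (Spec (.of (AdjoinRoot ((X : R[X]) ^ p - C a)))) := fun h =>
  haveI : Fact (Nat.Prime 2) := ⟨Nat.prime_two⟩
  picoverLocalModel_false_without_red_at 2 (h 2 Nat.prime_two)

/-! ## §3 Regularity of `R`: at `a = 0` the model is `Spec R` -/

section Zero

variable (p : ℕ) (R : Type) [CommRing R]

/-- `(R[T]/(T^p))_red ≃ R` for `R` reduced and `p ≠ 0` (evaluation at `T = 0`; its kernel is the
nilradical `(T)`). [folklore] -/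
theorem nonempty_localModelRing_zero_equiv [_root_.IsReduced R] (hp : p ≠ 0) :
    Nonempty ((AdjoinRoot (X ^ p - C (0 : R)) ⧸ nilradical (AdjoinRoot (X ^ p - C (0 : R))))
      ≃+* R) := by
  let ev : AdjoinRoot ((X : R[X]) ^ p - C 0) →+* R :=
    AdjoinRoot.lift (RingHom.id R) 0 (by rw [eval₂_sub, eval₂_X_pow, eval₂_C, zero_pow hp]; simp)
  have hsurj : Function.Surjective ev := fun r => ⟨AdjoinRoot.of _ r, by simp [ev]⟩
  have hker : RingHom.ker ev = nilradical (AdjoinRoot ((X : R[X]) ^ p - C 0)) := by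
    apply le_antisymm
    · intro x hx
      rw [RingHom.mem_ker] at hx
      rw [mem_nilradical]
      induction x using AdjoinRoot.induction_on with
      | ih q =>
        have hq : q = X * q.divX + C (q.coeff 0) := (X_mul_divX_add q).symm
        have h0 : q.coeff 0 = 0 := by
          simpa [ev, AdjoinRoot.lift_mk, coeff_zero_eq_eval_zero, eval₂_id] using hx
        have hq' : q = X * q.divX := by
          conv_lhs => rw [hq, h0, map_zero, add_zero]
        rw [hq', map_mul, AdjoinRoot.mk_X]
        exact Commute.isNilpotent_mul_right (Commute.all _ _)
          (isNilpotent_root_X_pow_sub_C_zero R p)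
    · intro x hx
      rw [mem_nilradical] at hx
      obtain ⟨n, hn⟩ := hx
      rw [RingHom.mem_ker]
      have : (ev x) ^ n = 0 := by rw [← map_pow, hn, map_zero]
      exact IsReduced.eq_zero _ ⟨n, this⟩
  exact ⟨(Ideal.quotEquivOfEq hker.symm).trans (RingHom.quotientKerEquivOfSurjective hsurj)⟩

/-- **At `a = 0` the model is `Spec R`**: it has a resolution iff `Spec R` has one (`R` reduced,
`p ≠ 0`). [folklore] -/
theorem hasResolution_localModel_zero_iff [_root_.IsReduced R] (hp : p ≠ 0) :
    Scheme.HasResolution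
        (Spec (.of (AdjoinRoot (X ^ p - C (0 : R)) ⧸ nilradical (AdjoinRoot (X ^ p - C (0 : R))))))
      ↔ Scheme.HasResolution (Spec (.of R)) := by
  obtain ⟨e⟩ := nonempty_localModelRing_zero_equiv p R hp
  constructor
  · intro h
    exact h.of_iso (Spec.map e.symm.toCommRingCatIso.hom)
  · intro h
    exact h.of_iso (Spec.map e.toCommRingCatIso.hom)

end Zero

/-- **Dropping `IsRegularRing R` turns the crux into resolution of EVERY integral affine scheme
of finite type over every field of positive characteristic** (take `a = 0`) — the affine heart of
the summit, open from dimension `4`. [folklore] -/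
theorem affineRes_of_picoverLocalModel_without_regular
    (h : ∀ p : ℕ, p.Prime → ∀ (k : Type) [Field k] [CharP k p] (R : Type) [CommRing R]
      [IsDomain R] [Algebra k R], Algebra.FiniteType k R → ∀ a : R,
        Scheme.HasResolution
          (Spec (.of (AdjoinRoot (X ^ p - C a) ⧸ nilradical (AdjoinRoot (X ^ p - C a))))))
    (p : ℕ) (hp : p.Prime) (k : Type) [Field k] [CharP k p] (R : Type) [CommRing R] [IsDomain R]
    [Algebra k R] (hR : Algebra.FiniteType k R) : Scheme.HasResolution (Spec (.of R)) :=
  (hasResolution_localModel_zero_iff p R hp.ne_zero).mp (h p hp k R hR 0)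

/-- … and conversely the summit implies the crux with `IsRegularRing R` dropped. [folklore] -/
theorem picoverLocalModel_without_regular_of_summit (h : _root_.ResolutionOfSingularities) :
    ∀ p : ℕ, p.Prime → ∀ (k : Type) [Field k] [CharP k p] (R : Type) [CommRing R]
      [IsDomain R] [Algebra k R], Algebra.FiniteType k R → ∀ a : R,
        Scheme.HasResolution
          (Spec (.of (AdjoinRoot (X ^ p - C a) ⧸ nilradical (AdjoinRoot (X ^ p - C a))))) :=
  fun p hp k _ _ R _ _ _ hft a => localModel_of_resolutionInChar p (h p hp) k R hft a

/-! ## §5 Degenerate instances do not bite -/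

/-- `a = 0`: the model `Spec R` of a regular reduced ring is its own resolution. [folklore] -/
theorem localModel_zero (p : ℕ) (hp : p ≠ 0) (R : Type) [CommRing R] [IsRegularRing R]
    [_root_.IsReduced R] :
    Scheme.HasResolution
      (Spec (.of (AdjoinRoot (X ^ p - C (0 : R)) ⧸ nilradical (AdjoinRoot (X ^ p - C (0 : R)))))) := by
  rw [hasResolution_localModel_zero_iff p R hp]
  refine Scheme.IsRegular.hasResolution fun x => ?_
  haveI : IsRegularLocalRing (Localization.AtPrime x.asIdeal) :=
    IsRegularRing.isRegularLocalRing_localization x.asIdeal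
  exact IsRegularLocalRing.of_ringEquiv (Spec.stalkIso (.of R) x).commRingCatIsoToRingEquiv.symm

/-- **Non-vacuity**: at every prime the hypotheses of the crux are jointly satisfiable and the
conclusion holds at the witness (`k = R = 𝔽_p`, `a = 0`). [folklore] -/
theorem picoverLocalModel_hypotheses_satisfiable (p : ℕ) [Fact p.Prime] :
    ∃ (k : Type) (_ : Field k) (_ : CharP k p) (R : Type) (_ : CommRing R) (_ : IsDomain R)
      (_ : Algebra k R) (a : R), Algebra.FiniteType k R ∧ IsRegularRing R ∧
        Scheme.HasResolution
          (Spec (.of (AdjoinRoot (X ^ p - C a) ⧸ nilradical (AdjoinRoot (X ^ p - C a))))) :=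
  ⟨ZMod p, inferInstance, inferInstance, ZMod p, inferInstance, inferInstance, inferInstance, 0,
    inferInstance, inferInstance, localModel_zero p (Nat.Prime.ne_zero Fact.out) (ZMod p)⟩

end Summit.ResolutionOfSingularities.ResolutionOfSingularities.Theorems.PicoverLocalModel.Negative

end
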